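import Summits.AtomisticToContinuum.HydrodynamicLimit.Theorems.InformationPercolationEngineChaosClosesEulerReadoutMeasurable
import Literature.Analysis.FluidPDE.HardSpherePhaseSpaceProofs
import Literature.Analysis.FunctionSpaces.TorusCalculusProofs
import HarnessLib

/-!
# Kinetic reduction (crux `ChaosClosesEuler`, stmt-AtomisticToContinuum-15141, line `Sketch`,
# stub `stub_kineticReduction`) — helper: space–time regularity of the classical Euler fields

WHAT. For a field `w` jointly smooth on `[0, T) × 𝕋³` (`Torus.IsSmoothSpaceTimeOn (Ico 0 T) w`, the regularity of
a classical hard-sphere Euler solution), the derived fields entering the BF18 shell — the one-sided time derivative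
`∂ₜw`, the space derivatives `Dw(·)v`, the partial derivatives of the components of a vector field, the gradient of a
scalar field — are jointly continuous on `[0, T) × 𝕋³` (they are the space–time derivative of the lift, continuous on
the set of unique differentiability `[0, T) × ℝ³`, read through the open quotient map). Consequences on compact
windows `[a, b] ⊆ [0, T)`: bounds, and joint moduli of continuity in time and in the minimal-image distance
(`exists_modulus`). Also: a translation bound of the minimal-image distance.

REFERENCES. Elementary calculus on the flat torus (L. Grafakos, *Classical Fourier Analysis*, §3.1). No named
fact is invoked.
-/

noncomputable section

namespace Summit.AtomisticToContinuum.HydrodynamicLimit.Theorems.ChaosClosesEulerReduction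

open Set Filter Topology Function
open scoped ContDiff InnerProductSpace
open Literature.MathematicalPhysics.KineticTheory
open Literature.Analysis.FluidPDE
open Literature.Analysis.FunctionSpaces

/-! ## §1 The minimal-image distance -/

/-- Two translates of one point are at minimal-image distance at most the distance of the displacements. [folklore] -/
theorem euclidDist_add_proj_le (y : T3) (a b : V3) : Torus.euclidDist (y + Torus.proj a) (y + Torus.proj b) ≤ ‖a - b‖ := by
  obtain ⟨c, hc⟩ := Torus.proj_surjective y
  have h1 : y + Torus.proj a = Torus.proj (c + a) := by rw [Torus.proj_add, hc]
  have h2 : y + Torus.proj b = Torus.proj (c + b) := by rw [Torus.proj_add, hc]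
  rw [h1, h2]
  refine (Torus.euclidDist_proj_le_norm_sub_holds _ _).trans (le_of_eq ?_)
  congr 1; abel

/-! ## §2 Joint continuity of the derived fields -/

section Smooth

variable {F : Type*} [NormedAddCommGroup F] [NormedSpace ℝ F] {T : ℝ} {w : ℝ → T3 → F}

/-- `[0, T) × ℝ³` is a set of unique differentiability. [folklore] -/
theorem uniqueDiffOn_Ico_prod (T : ℝ) : UniqueDiffOn ℝ (Ico 0 T ×ˢ (univ : Set V3)) :=
  (uniqueDiffOn_Ico 0 T).prod uniqueDiffOn_univ

/-- The space–time derivative of the lift of a field smooth on `[0, T) × 𝕋³` is continuous on `[0, T) × ℝ³`. [folklore] -/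
theorem continuousOn_fderivWithin_stLift (hw : Torus.IsSmoothSpaceTimeOn (Ico 0 T) w) :
    ContinuousOn (fderivWithin ℝ (Torus.stLift w) (Ico 0 T ×ˢ univ)) (Ico 0 T ×ˢ (univ : Set V3)) :=
  hw.continuousOn_fderivWithin (uniqueDiffOn_Ico_prod T) (by simp)

/-- **The space derivative of a time slice is the space–time derivative of the lift in the direction `(0, v)`.**
[folklore] -/
theorem fderiv_slice_eq (hw : Torus.IsSmoothSpaceTimeOn (Ico 0 T) w) {s : ℝ} (hs : s ∈ Ico 0 T) (ξ v : V3) :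
    Torus.fderiv (w s) (Torus.proj ξ) v = fderivWithin ℝ (Torus.stLift w) (Ico 0 T ×ˢ univ) (s, ξ) ((0 : ℝ), v) := by
  have h1 : HasFDerivWithinAt (Torus.stLift w) (fderivWithin ℝ (Torus.stLift w) (Ico 0 T ×ˢ univ) (s, ξ))
      (Ico 0 T ×ˢ univ) (s, ξ) :=
    (hw.differentiableOn (by simp) (s, ξ) (mk_mem_prod hs (mem_univ _))).hasFDerivWithinAt
  have h2 : HasFDerivWithinAt (fun η : V3 => ((s, η) : ℝ × V3)) (ContinuousLinearMap.inr ℝ ℝ V3) univ ξ :=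
    (hasFDerivAt_prodMk_right s ξ).hasFDerivWithinAt
  have hcomp := h1.comp ξ h2 fun η _ => mk_mem_prod hs (mem_univ _)
  rw [hasFDerivWithinAt_univ] at hcomp
  have hlift : Torus.lift (w s) = Torus.stLift w ∘ fun η : V3 => ((s, η) : ℝ × V3) := by
    funext η; rfl
  rw [← Torus.fderiv_lift, hlift, hcomp.fderiv]
  rfl

/-- **Joint continuity of the space derivatives** `(s, x) ↦ D(w s)(x) v` on `[0, T) × 𝕋³`. [folklore] -/
theorem continuousOn_fderiv_slice_apply (hw : Torus.IsSmoothSpaceTimeOn (Ico 0 T) w) (v : V3) :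
    ContinuousOn (uncurry fun s x => Torus.fderiv (w s) x v) (Ico 0 T ×ˢ univ) := by
  refine Torus.continuousOn_uncurry_of_continuousOn_stLift ?_
  have heq : EqOn (Torus.stLift fun s x => Torus.fderiv (w s) x v)
      (fun p => fderivWithin ℝ (Torus.stLift w) (Ico 0 T ×ˢ univ) p ((0 : ℝ), v)) (Ico 0 T ×ˢ univ) := by
    intro p hp
    exact fderiv_slice_eq hw hp.1 p.2 v
  exact ((continuousOn_fderivWithin_stLift hw).clm_apply continuousOn_const).congr heq

/-- **Joint continuity of the one-sided time derivative** `(s, x) ↦ ∂ₜw(s, x)` on `[0, T) × 𝕋³`. [folklore] -/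
theorem continuousOn_timeDerivWithin (hw : Torus.IsSmoothSpaceTimeOn (Ico 0 T) w) :
    ContinuousOn (uncurry (Torus.timeDerivWithin (Ico 0 T) w)) (Ico 0 T ×ˢ univ) := by
  refine Torus.continuousOn_uncurry_of_continuousOn_stLift ?_
  have heq : EqOn (Torus.stLift (Torus.timeDerivWithin (Ico 0 T) w))
      (fun p => fderivWithin ℝ (Torus.stLift w) (Ico 0 T ×ˢ univ) p ((1 : ℝ), (0 : V3))) (Ico 0 T ×ˢ univ) := by
    intro p hp
    exact hw.timeDerivWithin_apply_proj (uniqueDiffOn_Ico 0 T) hp.1 p.2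
  exact ((continuousOn_fderivWithin_stLift hw).clm_apply continuousOn_const).congr heq

/-- **Joint continuity of the field itself** on `[0, T) × 𝕋³`. [folklore] -/
theorem continuousOn_uncurry (hw : Torus.IsSmoothSpaceTimeOn (Ico 0 T) w) :
    ContinuousOn (uncurry w) (Ico 0 T ×ˢ univ) :=
  Torus.continuousOn_uncurry_of_continuousOn_stLift hw.continuousOn_stLift

/-- Time slices are `C¹`. [folklore] -/
theorem isContDiff_one_slice (hw : Torus.IsSmoothSpaceTimeOn (Ico 0 T) w) {s : ℝ} (hs : s ∈ Ico 0 T) :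
    Torus.IsContDiff 1 (w s) :=
  (hw.isSmooth_slice hs).isContDiff (by simp)

/-- The partial derivatives of a time slice through its Fréchet derivative. [folklore] -/
theorem partialDeriv_slice_eq (hw : Torus.IsSmoothSpaceTimeOn (Ico 0 T) w) {s : ℝ} (hs : s ∈ Ico 0 T) (k : Fin 3)
    (x : T3) : Torus.partialDeriv k (w s) x = Torus.fderiv (w s) x (EuclideanSpace.single k 1) :=
  Torus.partialDeriv_eq_fderiv_apply (isContDiff_one_slice hw hs) k x

/-- **Joint continuity of the partial derivatives** `(s, x) ↦ ∂ₖ(w s)(x)` on `[0, T) × 𝕋³`. [folklore] -/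
theorem continuousOn_partialDeriv (hw : Torus.IsSmoothSpaceTimeOn (Ico 0 T) w) (k : Fin 3) :
    ContinuousOn (uncurry fun s x => Torus.partialDeriv k (w s) x) (Ico 0 T ×ˢ univ) :=
  (continuousOn_fderiv_slice_apply hw (EuclideanSpace.single k 1)).congr fun p hp =>
    partialDeriv_slice_eq hw hp.1 k p.2

end Smooth

/-! ## §3 Components of vector fields and gradients of scalar fields -/

/-- **Registered sub-goal `stub_reductionEuler` (helper of `stub_kineticReduction`): the partial derivative of a
component of a `C¹` vector field on `𝕋³` is the component of its Fréchet derivative** (the velocity gradient of the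
classical solution enters the BF18 momentum residual componentwise). [folklore] -/
theorem stub_reductionEuler : ∀ {u : T3 → V3}, Torus.IsContDiff 1 u → ∀ (k i : Fin 3) (x : T3), Torus.partialDeriv k (fun y => u y i) x = (Torus.fderiv u x (EuclideanSpace.single k 1)) i := by
  intro u hu k i x
  have hui : Torus.IsContDiff 1 fun y => u y i := by
    change ContDiff ℝ 1 ((EuclideanSpace.proj i : V3 →L[ℝ] ℝ) ∘ Torus.lift u)
    exact (EuclideanSpace.proj i : V3 →L[ℝ] ℝ).contDiff.comp hu
  rw [Torus.partialDeriv_eq_fderiv_apply hui]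
  unfold Torus.fderiv
  have hdiff : DifferentiableAt ℝ (Torus.liftAt u x) 0 :=
    ((hu.liftAt x).differentiable (by norm_num)).differentiableAt
  have hcomp : Torus.liftAt (fun y => u y i) x = (EuclideanSpace.proj i : V3 →L[ℝ] ℝ) ∘ Torus.liftAt u x := by
    funext v; simp [Torus.liftAt_apply, EuclideanSpace.proj]
  rw [hcomp, fderiv_comp 0 (EuclideanSpace.proj i : V3 →L[ℝ] ℝ).differentiableAt hdiff, ContinuousLinearMap.fderiv]
  simp [EuclideanSpace.proj]

/-- The partial derivative of a component of a `C¹` vector field is the component of the Fréchet derivative.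
[folklore] -/
theorem partialDeriv_apply_eq {u : T3 → V3} (hu : Torus.IsContDiff 1 u) (k i : Fin 3) (x : T3) :
    Torus.partialDeriv k (fun y => u y i) x = (Torus.fderiv u x (EuclideanSpace.single k 1)) i :=
  stub_reductionEuler hu k i x

/-- **Joint continuity of the partial derivatives of the components of a vector field** smooth on `[0, T) × 𝕋³`.
[folklore] -/
theorem continuousOn_partialDeriv_apply {T : ℝ} {u : ℝ → T3 → V3} (hu : Torus.IsSmoothSpaceTimeOn (Ico 0 T) u)
    (k i : Fin 3) :
    ContinuousOn (uncurry fun s x => Torus.partialDeriv k (fun y => u s y i) x) (Ico 0 T ×ˢ univ) := by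
  have h := continuousOn_fderiv_slice_apply hu (EuclideanSpace.single k 1)
  have hi : Continuous fun v : V3 => v i := (EuclideanSpace.proj i : V3 →L[ℝ] ℝ).continuous
  refine (hi.comp_continuousOn h).congr fun p hp => ?_
  simp only [comp_apply]
  exact partialDeriv_apply_eq (isContDiff_one_slice hu hp.1) k i p.2

/-- **The gradient through the partial derivatives**: `∇f(x) = ∑ₖ ∂ₖf(x) eₖ` for `C¹` scalar `f`. [folklore] -/
theorem gradient_eq_sum_partialDeriv {f : T3 → ℝ} (hf : Torus.IsContDiff 1 f) (x : T3) :
    Torus.gradient f x = ∑ k : Fin 3, Torus.partialDeriv k f x • EuclideanSpace.single k (1 : ℝ) := by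
  have hrepr : Torus.gradient f x = ∑ k : Fin 3, (Torus.gradient f x) k • EuclideanSpace.single k (1 : ℝ) := by
    conv_lhs => rw [← (EuclideanSpace.basisFun (Fin 3) ℝ).sum_repr (Torus.gradient f x)]
    simp
  rw [hrepr]
  refine Finset.sum_congr rfl fun k _ => ?_
  congr 1
  have h := Torus.inner_gradient_left f x (EuclideanSpace.single k 1)
  rw [EuclideanSpace.inner_single_right] at h
  simp only [one_mul, conj_trivial] at h
  rw [h, Torus.partialDeriv_eq_fderiv_apply hf]

/-- The inner product of a vector with a gradient through the partial derivatives. [folklore] -/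
theorem inner_gradient_eq_sum {f : T3 → ℝ} (hf : Torus.IsContDiff 1 f) (m : V3) (x : T3) :
    ⟪m, Torus.gradient f x⟫_ℝ = ∑ k : Fin 3, m k * Torus.partialDeriv k f x := by
  rw [gradient_eq_sum_partialDeriv hf, inner_sum]
  refine Finset.sum_congr rfl fun k _ => ?_
  rw [inner_smul_right, EuclideanSpace.inner_single_right]
  simp [mul_comm]

/-- The gradient of a constant multiple: `∇(c f) = c ∇f` for `C¹` scalar `f`. [folklore] -/
theorem gradient_const_mul {f : T3 → ℝ} (hf : Torus.IsContDiff 1 f) (c : ℝ) (x : T3) :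
    Torus.gradient (fun y => c * f y) x = c • Torus.gradient f x := by
  have hcf : Torus.IsContDiff 1 fun y => c * f y := by
    change ContDiff ℝ 1 fun y => c * Torus.lift f y
    exact contDiff_const.mul hf
  rw [gradient_eq_sum_partialDeriv hcf, gradient_eq_sum_partialDeriv hf, Finset.smul_sum]
  refine Finset.sum_congr rfl fun k _ => ?_
  rw [smul_smul]
  congr 1
  have h := Torus.partialDeriv_smul (F := ℝ) (Torus.isContDiff_const c) hf k x
  simp only [smul_eq_mul] at h
  rw [h]
  have h0 : Torus.partialDeriv k (fun _ : T3 => c) x = 0 := by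
    rw [Torus.partialDeriv_eq_fderiv_apply (Torus.isContDiff_const c)]
    unfold Torus.fderiv Torus.liftAt
    simp
  rw [h0, zero_mul, add_zero]

/-- The gradient of a multiple by a constant on the right: `∇(f c) = c ∇f`. [folklore] -/
theorem gradient_mul_const {f : T3 → ℝ} (hf : Torus.IsContDiff 1 f) (c : ℝ) (x : T3) :
    Torus.gradient (fun y => f y * c) x = c • Torus.gradient f x := by
  simp_rw [mul_comm _ c]
  exact gradient_const_mul hf c x

/-! ## §4 One-sided time derivative of a product with a time cut-off -/

/-- **Product rule within `[0, T)`**: for `w` smooth on `[0, T) × 𝕋³` and `c : ℝ → ℝ` differentiable,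
`∂ₜ(w·c)(s, x) = ∂ₜw(s, x) c(s) + w(s, x) c'(s)` (one-sided derivatives within `[0, T)`, `s ∈ [0, T)`). [folklore] -/
theorem timeDerivWithin_mul_cut {T : ℝ} {w : ℝ → T3 → ℝ} (hw : Torus.IsSmoothSpaceTimeOn (Ico 0 T) w)
    {c : ℝ → ℝ} {c' : ℝ} {s : ℝ} (hc : HasDerivAt c c' s) (hs : s ∈ Ico 0 T) (x : T3) :
    Torus.timeDerivWithin (Ico 0 T) (fun s' y => w s' y * c s') s x =
      Torus.timeDerivWithin (Ico 0 T) w s x * c s + w s x * c' := by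
  unfold Torus.timeDerivWithin
  have h1 : HasDerivWithinAt (fun τ => w τ x) (Torus.timeDerivWithin (Ico 0 T) w s x) (Ico 0 T) s :=
    hw.hasDerivWithinAt_slice hs x
  have h : HasDerivWithinAt (fun τ => w τ x * c τ) (Torus.timeDerivWithin (Ico 0 T) w s x * c s + w s x * c') (Ico 0 T) s :=
    h1.mul hc.hasDerivWithinAt
  exact h.derivWithin (uniqueDiffOn_Ico 0 T s hs)

/-- If a function of time vanishes on a neighbourhood of `s` within... everywhere above a level below `s`, its
one-sided derivative within `[0, T)` at `s` vanishes. [folklore] -/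
theorem timeDerivWithin_eq_zero_of_eventually {T : ℝ} {f : ℝ → T3 → ℝ} {s : ℝ} (hs : s ∈ Ico 0 T) (x : T3)
    (h : ∀ᶠ s' in 𝓝 s, f s' x = 0) : Torus.timeDerivWithin (Ico 0 T) f s x = 0 := by
  unfold Torus.timeDerivWithin
  have h0 : HasDerivWithinAt (fun τ => f τ x) 0 (Ico 0 T) s := by
    have hc : HasDerivAt (fun _ : ℝ => (0 : ℝ)) 0 s := hasDerivAt_const s 0
    exact (hc.hasDerivWithinAt.congr_of_eventuallyEq (h.filter_mono nhdsWithin_le_nhds) (h.self_of_nhds))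
  exact h0.derivWithin (uniqueDiffOn_Ico 0 T s hs)

/-! ## §5 Compact windows: bounds and moduli of continuity -/

/-- **Joint modulus of continuity on a compact window.** A field jointly continuous on `[a, b] × 𝕋³` is uniformly
continuous there: for `e > 0` there is `d > 0` with `‖f s x − f s' x'‖ < e` whenever `s, s' ∈ [a, b]`, `|s − s'| < d`
and the minimal-image distance of `x, x'` is `< d`. [folklore] -/
theorem exists_modulus {G : Type*} [NormedAddCommGroup G] {a b : ℝ} {f : ℝ → T3 → G}
    (hf : ContinuousOn (uncurry f) (Icc a b ×ˢ univ)) {e : ℝ} (he : 0 < e) :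
    ∃ d : ℝ, 0 < d ∧ ∀ s ∈ Icc a b, ∀ s' ∈ Icc a b, |s - s'| < d → ∀ x x' : T3, Torus.euclidDist x x' < d →
      ‖f s x - f s' x'‖ < e := by
  have hK : IsCompact (Icc a b ×ˢ (univ : Set T3)) := isCompact_Icc.prod isCompact_univ
  obtain ⟨d, hd, hU⟩ := Metric.uniformContinuousOn_iff.1 (hK.uniformContinuousOn_of_continuous hf) e he
  refine ⟨d, hd, fun s hs s' hs' hss' x x' hxx' => ?_⟩
  have h := hU (s, x) (mk_mem_prod hs (mem_univ x)) (s', x') (mk_mem_prod hs' (mem_univ x')) (by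
    rw [Prod.dist_eq, Real.dist_eq]
    have hd : dist x x' ≤ Torus.euclidDist x x' := by rw [dist_eq_norm]; exact Torus.norm_sub_le_euclidDist_holds x x'
    exact max_lt hss' (hd.trans_lt hxx'))
  rwa [dist_eq_norm] at h

/-- A field continuous on `[0, T) × 𝕋³` is continuous on every compact window `[a, b] × 𝕋³`, `0 ≤ a`, `b < T`.
[folklore] -/
theorem continuousOn_window {G : Type*} [TopologicalSpace G] {T a b : ℝ} {f : ℝ → T3 → G}
    (hf : ContinuousOn (uncurry f) (Ico 0 T ×ˢ univ)) (ha : 0 ≤ a) (hb : b < T) :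
    ContinuousOn (uncurry f) (Icc a b ×ˢ univ) :=
  hf.mono (prod_mono (fun _ hs => ⟨ha.trans hs.1, hs.2.trans_lt hb⟩) subset_rfl)

/-- **The constants of a classical field on a window.** For `w` smooth on `[0, T) × 𝕋³` and a window `[0, b]`,
`b < T`: one constant bounding `‖w‖`, `‖∂ₜw‖` and all `‖∂ₖw‖` on `[0, b] × 𝕋³`. [folklore] -/
theorem exists_window_bound {F : Type*} [NormedAddCommGroup F] [NormedSpace ℝ F] {T b : ℝ} {w : ℝ → T3 → F}
    (hw : Torus.IsSmoothSpaceTimeOn (Ico 0 T) w) (hb : b < T) :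
    ∃ C : ℝ, 1 ≤ C ∧ (∀ s ∈ Icc 0 b, ∀ x, ‖w s x‖ ≤ C) ∧
      (∀ s ∈ Icc 0 b, ∀ x, ‖Torus.timeDerivWithin (Ico 0 T) w s x‖ ≤ C) ∧
      ∀ k : Fin 3, ∀ s ∈ Icc 0 b, ∀ x, ‖Torus.partialDeriv k (w s) x‖ ≤ C := by
  obtain ⟨C0, -, hC0⟩ := ChaosClosesEulerReadout.exists_bound_of_continuousOn_uncurry
    (continuousOn_window (continuousOn_uncurry hw) le_rfl hb)
  obtain ⟨C1, -, hC1⟩ := ChaosClosesEulerReadout.exists_bound_of_continuousOn_uncurry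
    (continuousOn_window (continuousOn_timeDerivWithin hw) le_rfl hb)
  have hk : ∀ k : Fin 3, ∃ C, 0 ≤ C ∧ ∀ s ∈ Icc 0 b, ∀ x, ‖Torus.partialDeriv k (w s) x‖ ≤ C := fun k =>
    ChaosClosesEulerReadout.exists_bound_of_continuousOn_uncurry
      (continuousOn_window (continuousOn_partialDeriv hw k) le_rfl hb)
  choose Ck hCk0 hCk using hk
  refine ⟨1 + max C0 0 + max C1 0 + ∑ k, Ck k, ?_, fun s hs x => ?_, fun s hs x => ?_, fun k s hs x => ?_⟩
  · have : 0 ≤ ∑ k, Ck k := Finset.sum_nonneg fun k _ => hCk0 k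
    linarith [le_max_right C0 0, le_max_right C1 0]
  · have : 0 ≤ ∑ k, Ck k := Finset.sum_nonneg fun k _ => hCk0 k
    linarith [hC0 s hs x, le_max_left C0 0, le_max_right C1 0]
  · have : 0 ≤ ∑ k, Ck k := Finset.sum_nonneg fun k _ => hCk0 k
    linarith [hC1 s hs x, le_max_left C1 0, le_max_right C0 0]
  · have hk' : Ck k ≤ ∑ k, Ck k := Finset.single_le_sum (fun k _ => hCk0 k) (Finset.mem_univ k)
    linarith [hCk k s hs x, le_max_right C0 0, le_max_right C1 0]

end Summit.AtomisticToContinuum.HydrodynamicLimit.Theorems.ChaosClosesEulerReduction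

end
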